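import Literature.Geometry.Kaehler.ComplexTorusHodgeClasses
import Literature.AlgebraicGeometry.HodgeTheory.ComplexTorusHodgeNumbers
import Literature.LinearAlgebra.Alternating.WedgeWordsDet
import HarnessLib

/-!
# `Hᵏ(X, ℚ)` of a complex torus has the basis of increasing lattice monomials; `b_k = C(2g, k)` over `ℚ`

Layer `Literature/Geometry/Kaehler`, namespace `Literature.Geometry.Kaehler.ComplexTorus`; lane
`lit-hodgefound`, Layer A4, row A4-11 (P-row "rationalForms = span latMonomial, finrank") and validation
V-A4-2 ("`B¹` of `ℂ/(ℤ+ℤτ)` is all of `H²`, rank `1`") of `run/shared/lean/pub/lit-hodgefound/SKELETON.md`.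
Sequel of `ComplexTorusHodgeClasses.lean` (`integralForms`, `rationalForms`, `hodgeClasses`).

Source: H. Lange, *Abelian Varieties over the Complex Numbers* (2023), held copy
`book:lange1992-complex-abelian-varieties`: §1.1.3 Lemma 1.1.17, Cor. 1.1.19, Exercise 1.1.6 (7)–(8)
[p0023, p0027] (`Hⁿ(X, ℤ) ≅ Altⁿ(Λ, ℤ) = ⋀ⁿ Hom(Λ, ℤ)`, free of rank `C(2g, n)`), §1.1.4 Prop. 1.1.20
[p0024] ("the classes of the `n`-forms `dx_{i₁} ∧ ⋯ ∧ dx_{iₙ}`, `i₁ < ⋯ < iₙ`, form a basis of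
`Hⁿ(X, ℂ)`"; `∫_{λᵢ} dxⱼ = δᵢⱼ`, "the bases `dx₁, …, dx_{2g}` and `λ₁, …, λ_{2g}` are dual to each
other").

## Contents (theorems only; no definition, no named fact)

For a period isomorphism `Φ : ℝ^ι ≃ E`:
* `latMonomial_apply_latticeTuple` — the determinant formula: `dx_w(Φm₀, …, Φm_{k-1}) = det (m_j(w_i))`
  (tree `wedgeWord_apply`), hence `latMonomial_mem_integralForms`: **the lattice monomials are
  integral classes** (`dx_I ∈ Hᵏ(X, ℤ)`);
* `latMonomialBasis_repr_eq_apply` — the coordinates of `γ` in the basis of increasing lattice monomials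
  are its values on the increasing tuples of lattice basis vectors (duality of Prop. 1.1.20);
* `mem_rationalForms_iff_forall_single` — `γ ∈ Hᵏ(X, ℚ)` iff its values on `k`-tuples of lattice BASIS
  vectors are rational (the formulation used by `HodgeTheory.IsRationalDeRhamFamily`);
* **`rationalForms_eq_span_latMonomial`** — `Hᵏ(X, ℚ) = span_ℚ {dx_w : w increasing}`, and
  **`finrank_rationalForms`**: `dim_ℚ Hᵏ(X, ℚ) = #{increasing words} = C(|ι|, k)`
  (`finrank_rationalForms_eq_choose`; Exercise 1.1.6 (8));
* `finrank_hodgeClasses_eq_one_of_finrank_eq` — in top degree `dim_ℚ H^{2g}_Hodge(X) = 1`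
  (`|ι| = 2g`); in particular **`dim_ℚ H²_Hodge(ℂ/Λ) = 1` for every one-dimensional complex torus**
  (validation V-A4-2 of TRIBUNAL-A).

## References

* [Lange2023AbelianVarietiesComplex] H. Lange, *Abelian Varieties over the Complex Numbers* (2023),
  §1.1.3 Lemma 1.1.17, Cor. 1.1.19, Exercise 1.1.6 (7)–(8); §1.1.4 Prop. 1.1.20.
* [Warner1983] F. W. Warner, *Foundations of Differentiable Manifolds and Lie Groups* (1983), 2.6.
-/

noncomputable section

open scoped Manifold ContDiff Topology Real
open Set Function Complex Finset Module
open Literature.LinearAlgebra.Alternating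
open Literature.Analysis.Complex (IsOfTypeAt)

namespace Literature.Geometry.Kaehler

namespace ComplexTorus

section Basis

variable {ι : Type*} {E : Type*} [NormedAddCommGroup E] [NormedSpace ℂ E] (Φ : (ι → ℝ) ≃L[ℝ] E)

/-! ### The lattice monomials are integral -/

/-- **Determinant formula on lattice tuples**: `dx_w(Φm₀, …, Φm_{k-1}) = det (m_j(w_i))ᵢⱼ`, an
integer (Warner 2.6 / tree `wedgeWord_apply`, with `xₐ(Φ m) = mₐ`).
[cite: Lange2023AbelianVarietiesComplex, §1.1.4 Prop. 1.1.20] -/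
theorem latMonomial_apply_latticeTuple {k : ℕ} (w : Fin k → ι) (m : Fin k → (ι → ℤ)) :
    latMonomial Φ k w (latticeTuple Φ m) = ((Matrix.of fun i j ↦ m j (w i)).det : ℤ) := by
  rw [latMonomial_eq, wedgeWord_apply]
  have hM : pairingMatrix (fun a ↦ (coord Φ a).smulRight (1 : ℂ)) w (latticeTuple Φ m) =
      (Matrix.of fun i j ↦ m j (w i)).map (Int.cast : ℤ → ℂ) := by
    ext i j
    rw [pairingMatrix_apply, ContinuousLinearMap.smulRight_apply, latticeTuple_apply, coord_apply,
      symm_latticeVec_apply, Matrix.map_apply, Matrix.of_apply, Complex.real_smul, mul_one]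
    norm_cast
  rw [hM]
  have hdet : ((Matrix.of fun i j ↦ m j (w i)).map (Int.cast : ℤ → ℂ)).det =
      (((Matrix.of fun i j ↦ m j (w i)).det : ℤ) : ℂ) :=
    (RingHom.map_det (Int.castRingHom ℂ) _).symm
  rw [hdet]
  change (((Matrix.of fun i j ↦ m j (w i)).det : ℤ) : ℂ) • (1 : ℂ) = _
  rw [smul_eq_mul, mul_one]

/-- **The lattice monomials `dx_w` are integral classes** (`Hᵏ(X, ℤ) = Altᵏ(Λ, ℤ)` contains the
`dx_{i₁} ∧ ⋯ ∧ dx_{i_k}`; Lange 2023, Lemma 1.1.17, Exercise 1.1.6 (7), Prop. 1.1.20).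
[cite: Lange2023AbelianVarietiesComplex, §1.1.3 Exercise 1.1.6 (7)] -/
theorem latMonomial_mem_integralForms (k : ℕ) (w : Fin k → ι) : latMonomial Φ k w ∈ integralForms Φ k :=
  fun m ↦ ⟨_, latMonomial_apply_latticeTuple Φ w m⟩

/-- The lattice monomials are rational classes. [cite: Lange2023AbelianVarietiesComplex, §1.1.3 Cor. 1.1.19] -/
theorem latMonomial_mem_rationalForms (k : ℕ) (w : Fin k → ι) : latMonomial Φ k w ∈ rationalForms Φ k :=
  mem_rationalForms_of_mem_integralForms Φ (latMonomial_mem_integralForms Φ k w)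

/-! ### Coordinates in the monomial basis; `Hᵏ(X, ℚ)` is the `ℚ`-span of the increasing monomials -/

section Ordered

variable [Fintype ι] [LinearOrder ι]

/-- **Duality (Prop. 1.1.20)**: the coordinate of `γ ∈ Alt^k_ℝ(E; ℂ)` along the increasing monomial
`dx_w` is the value `γ(λ_{w 0}, …, λ_{w (k-1)})` on the corresponding lattice basis vectors.
[cite: Lange2023AbelianVarietiesComplex, §1.1.4 Prop. 1.1.20] -/
theorem latMonomialBasis_repr_eq_apply {k : ℕ} (γ : E [⋀^Fin k]→L[ℝ] ℂ)
    (w : {w : Fin k → ι // StrictMono w}) :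
    (latMonomialBasis Φ k).repr γ w = γ (fun i ↦ Φ (Pi.single (w.1 i) 1)) := by
  classical
  conv_rhs => rw [← (latMonomialBasis Φ k).sum_repr γ]
  rw [ContinuousAlternatingMap.sum_apply, Finset.sum_eq_single w]
  · rw [ContinuousAlternatingMap.smul_apply, latMonomialBasis_apply, latMonomial,
      show (fun i ↦ Φ (Pi.single (w.1 i) (1 : ℝ))) = (fun a ↦ Φ (Pi.single a 1)) ∘ w.1 from rfl,
      frameWord_apply_comp_strictMono (coord Φ) (fun a ↦ Φ (Pi.single a 1)) (coord_dual Φ) w.2 w.2,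
      if_pos rfl, smul_eq_mul, mul_one]
  · intro u _ hu
    rw [ContinuousAlternatingMap.smul_apply, latMonomialBasis_apply, latMonomial,
      show (fun i ↦ Φ (Pi.single (w.1 i) (1 : ℝ))) = (fun a ↦ Φ (Pi.single a 1)) ∘ w.1 from rfl,
      frameWord_apply_comp_strictMono (coord Φ) (fun a ↦ Φ (Pi.single a 1)) (coord_dual Φ) u.2 w.2,
      if_neg (fun h ↦ hu (Subtype.ext h)), smul_zero]
  · intro h; exact absurd (Finset.mem_univ w) h

/-- A form with rational values on the increasing tuples of lattice basis vectors is the rational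
combination `Σ_w γ(λ_w) dx_w` of lattice monomials. [cite: Lange2023AbelianVarietiesComplex, §1.1.4 Prop. 1.1.20] -/
theorem mem_span_latMonomial_of_forall_strictMono {k : ℕ} {γ : E [⋀^Fin k]→L[ℝ] ℂ}
    (h : ∀ w : {w : Fin k → ι // StrictMono w},
      ∃ q : ℚ, γ (fun i ↦ Φ (Pi.single (w.1 i) 1)) = q) :
    γ ∈ Submodule.span ℚ (Set.range fun w : {w : Fin k → ι // StrictMono w} ↦ latMonomial Φ k w.1) := by
  choose q hq using h
  rw [← (latMonomialBasis Φ k).sum_repr γ]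
  refine Submodule.sum_mem _ fun w _ ↦ ?_
  rw [latMonomialBasis_repr_eq_apply, hq w, latMonomialBasis_apply, Rat.cast_smul_eq_qsmul ℂ (q w)]
  exact Submodule.smul_mem _ _ (Submodule.subset_span ⟨w, rfl⟩)

/-- **`Hᵏ(X, ℚ)` is the `ℚ`-span of the increasing lattice monomials `dx_{i₁} ∧ ⋯ ∧ dx_{i_k}`**
(Lange 2023, Prop. 1.1.20 with Lemma 1.1.17 / Exercise 1.1.6 (7): `Hᵏ(X, ℤ) = ⋀ᵏ Hom(Λ, ℤ)` has the
basis `dx_I`). [cite: Lange2023AbelianVarietiesComplex, §1.1.4 Prop. 1.1.20] -/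
theorem rationalForms_eq_span_latMonomial (k : ℕ) :
    rationalForms Φ k =
      Submodule.span ℚ (Set.range fun w : {w : Fin k → ι // StrictMono w} ↦ latMonomial Φ k w.1) := by
  classical
  refine le_antisymm (fun γ hγ ↦ mem_span_latMonomial_of_forall_strictMono Φ fun w ↦ ?_)
    (Submodule.span_le.2 ?_)
  · obtain ⟨q, hq⟩ := hγ (fun i ↦ Pi.single (w.1 i) 1)
    refine ⟨q, ?_⟩
    rw [← hq]
    congr 1
    funext i
    rw [latticeTuple_apply, latticeVec_single]
  · rintro _ ⟨w, rfl⟩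
    exact latMonomial_mem_rationalForms Φ k w.1

/-- The increasing lattice monomials are `ℚ`-linearly independent (they are `ℂ`-independent).
[cite: Lange2023AbelianVarietiesComplex, §1.1.4 Prop. 1.1.20] -/
theorem linearIndependent_rat_latMonomial (k : ℕ) :
    LinearIndependent ℚ fun w : {w : Fin k → ι // StrictMono w} ↦ latMonomial Φ k w.1 := by
  have h := (latMonomialBasis Φ k).linearIndependent
  have h' : LinearIndependent ℂ fun w : {w : Fin k → ι // StrictMono w} ↦ latMonomial Φ k w.1 := by
    convert h using 1
    funext w
    rw [latMonomialBasis_apply]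
  exact h'.restrict_scalars fun a b hab ↦ by simpa only [Rat.smul_one_eq_cast, Rat.cast_inj] using hab

/-- **`dim_ℚ Hᵏ(X, ℚ) = #{increasing words of length k}`.** [cite: Lange2023AbelianVarietiesComplex, §1.1.3 Exercise 1.1.6 (8)] -/
theorem finrank_rationalForms (k : ℕ) :
    finrank ℚ (rationalForms Φ k) = Fintype.card {w : Fin k → ι // StrictMono w} := by
  rw [rationalForms_eq_span_latMonomial, finrank_span_eq_card (linearIndependent_rat_latMonomial Φ k)]

/-- `γ ∈ Hᵏ(X, ℚ)` iff its values on all `k`-tuples of lattice BASIS vectors `λₐ = Φ(eₐ)` are rational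
(equivalent to rationality on all lattice tuples by multilinearity; the formulation of the tree's
`HodgeTheory.IsRationalDeRhamFamily`). [cite: Lange2023AbelianVarietiesComplex, §1.1.3 Lemma 1.1.17] -/
theorem mem_rationalForms_iff_forall_single {k : ℕ} {γ : E [⋀^Fin k]→L[ℝ] ℂ} :
    γ ∈ rationalForms Φ k ↔
      ∀ v : Fin k → ι, γ (fun j ↦ Φ (Pi.single (v j) 1)) ∈ Set.range (algebraMap ℚ ℂ) := by
  constructor
  · intro hγ v
    obtain ⟨q, hq⟩ := hγ (fun j ↦ Pi.single (v j) 1)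
    refine ⟨q, ?_⟩
    rw [eq_ratCast, ← hq]
    congr 1
    funext j
    rw [latticeTuple_apply, latticeVec_single]
  · intro h
    rw [rationalForms_eq_span_latMonomial]
    refine mem_span_latMonomial_of_forall_strictMono Φ fun w ↦ ?_
    obtain ⟨q, hq⟩ := h w.1
    exact ⟨q, by rw [← hq, eq_ratCast]⟩

end Ordered

section Finite

variable [Fintype ι]

/-- **`b_k(X; ℚ) = C(2g, k)`**: `dim_ℚ Hᵏ(X, ℚ) = C(|ι|, k)` (`|ι| = rk Λ = 2 dim_ℂ X`; Lange 2023,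
Exercise 1.1.6 (8): "`Hⁿ(X, ℤ)` is a free abelian group of rank `C(2g, n)`").
[cite: Lange2023AbelianVarietiesComplex, §1.1.3 Exercise 1.1.6 (8)] -/
theorem finrank_rationalForms_eq_choose (k : ℕ) :
    finrank ℚ (rationalForms Φ k) = (Fintype.card ι).choose k := by
  letI : LinearOrder ι := LinearOrder.lift' (Fintype.equivFin ι) (Fintype.equivFin ι).injective
  rw [finrank_rationalForms, Literature.AlgebraicGeometry.HodgeTheory.card_strictMono_eq_choose]

include Φ in
/-- The rank of the lattice is the real dimension: `|ι| = dim_ℝ E = 2 dim_ℂ E`.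
[cite: Lange2023AbelianVarietiesComplex, §1.1.1] -/
theorem card_eq_two_mul_finrank [FiniteDimensional ℂ E] : Fintype.card ι = 2 * finrank ℂ E := by
  have h1 : finrank ℝ (ι → ℝ) = finrank ℝ E := LinearEquiv.finrank_eq Φ.toLinearEquiv
  rw [finrank_fintype_fun_eq_card] at h1
  rw [h1, finrank_real_of_complex]

/-- **`dim_ℚ H^{2g}_Hodge(X) = 1`** (`g = dim_ℂ X`): in top degree the Hodge classes are all of
`H^{2g}(X, ℚ) ≅ ℚ` (the class of a point). For `g = 1`: **every one-dimensional complex torus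
`X = ℂ/Λ` has `H²_Hodge(X) = H²(X, ℚ)` of dimension `1`** (validation V-A4-2; Lange 2023, §7.3.3
Exercise (2), Exercise 1.3.4 (10)(b) `ρ ≤ g²`). [cite: Lange2023AbelianVarietiesComplex, §7.3.3 Exercise (2)] -/
theorem finrank_hodgeClasses_eq_one_of_finrank_eq [FiniteDimensional ℂ E] {g : ℕ}
    (hg : finrank ℂ E = g) : finrank ℚ (hodgeClasses Φ g) = 1 := by
  rw [hodgeClasses_eq_rationalForms_of_finrank_eq Φ hg, finrank_rationalForms_eq_choose,
    card_eq_two_mul_finrank Φ, hg, Nat.choose_self]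

/-- **The elliptic curve `ℂ/Λ`: `dim_ℚ H²_Hodge = 1`** (every rational class of `H²` is a Hodge class
and `b₂ = 1`). [cite: Lange2023AbelianVarietiesComplex, §7.3.3 Exercise (2)] -/
theorem finrank_hodgeClasses_one_of_finrank_eq_one [FiniteDimensional ℂ E] (h1 : finrank ℂ E = 1) :
    finrank ℚ (hodgeClasses Φ 1) = 1 :=
  finrank_hodgeClasses_eq_one_of_finrank_eq Φ h1

end Finite

end Basis

end ComplexTorus

end Literature.Geometry.Kaehler

end
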